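import Summits.HodgeConjecture.HodgeConjecture.Theorems.BoundaryReadoutAbsoluteReductionOfTwoFacts
import Literature.AlgebraicGeometry.HodgeTheory.RestrictionImageOfCompactificationProofs
import Literature.AlgebraicGeometry.HodgeTheory.ComplexOrientationFamily
import HarnessLib

/-!
# Route `BoundaryReadout` — crux `AbsoluteReduction` (stmt-HodgeConjecture-15945):
# the partie-fixe input brought down to Voisin II Prop. 4.23 and to its snc / period core

`Theorems/BoundaryReadoutAbsoluteReductionOfTwoFacts.lean` records the crux `AbsoluteReduction`
(Voisin 2007, Prop. 1.2, absolute reading) modulo exactly two inputs: Voisin's flat spread of an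
absolute class over `ℚ̄` (`voisin2007_flatSpread_of_isAbsoluteHodgeClass`) and Deligne's global
invariant cycle theorem (`deligne_globalInvariantCycles` = route item stmt-HodgeConjecture-16363).
Since then the tree has reduced the partie fixe itself: by `deligne_globalInvariantCycles_of_rangeRestrict`
(`RestrictionImageOfCompactification.lean`; Voisin II Thm. 4.18 is the tree THEOREM
`deligne1968_invariantClass_fromTotalSpace_holds`) it follows from the single printed proposition
`voisin2003_rangeRestrict_eq_of_compactification` (Voisin II, Prop. 4.23: for closed smooth projective
`Y ⊂ 𝒳 ⊂ 𝒳̄`, `𝒳̄` a smooth projective compactification, `Im(Hᵏ(𝒳̄) → Hᵏ(Y)) = Im(Hᵏ(𝒳) → Hᵏ(Y))`),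
and `RestrictionImageOfCompactificationProofs.lean` reduces that proposition further to its simple
normal crossings core (`…_of_snc`: complex coefficients, irreducible compactification, log resolution
of the boundary — Kollár Thm. 3.21 is in the tree) and to the vanishing of periods of pure-type classes
(`…_of_periods`). This file threads those reductions through to the crux BY NAME, so that the ledger's
bill for stmt-15945 is current:

* `absoluteReduction_of_flatSpread_of_rangeRestrict` — flat spread → Prop. 4.23 → `AbsoluteReduction`;
* `absoluteReduction_of_flatSpread_of_snc` — flat spread → (Prop. 4.23 for an snc compactification of
  `𝒳` by a smooth projective VARIETY, one inclusion, `ℂ`-coefficients) → `AbsoluteReduction`;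
* `absoluteReduction_of_flatSpread_of_periods` — flat spread → (vanishing of the periods
  `∫_Y u ∪ ι^*α`, `u` of pure Hodge type with `∫_Y u ∪ (ι ≫ i)^*β = 0` for all `β` on the snc
  compactification; orientations = the tree's `complexOrientationFamily`) → `AbsoluteReduction`.

All CONDITIONAL (the item stays open): the flat spread needs the algebraic de Rham dictionary
(conjugation charts: Jouanolou, Grothendieck comparison; Gauss–Manin flatness), the snc / period core
is Deligne's Hodge II §3.2 (logarithmic complex, `W_k = Im`, strictness) for the pair `(X', D)`.

## References

* C. Voisin, *Hodge loci and absolute Hodge classes*, Compositio Math. 143 (2007), §3, proof of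
  Prop. 1.2. [Voisin2007HodgeLoci]
* C. Voisin, *Hodge Theory and Complex Algebraic Geometry II* (CUP 2003), Thm. 4.18, Prop. 4.23,
  Thm. 4.24. [VoisinHodgeII2003]
* P. Deligne, *Théorie de Hodge II*, Publ. Math. IHÉS 40 (1971), Thm. 3.2.5, Cor. 3.2.17, Thm. 4.1.1.
  [DeligneHodgeII1971]
* J. Kollár, *Lectures on Resolution of Singularities* (PUP 2007), Thm. 3.21. [Kollar2007]
-/

-- every declaration of this problem lives in `Summit.HodgeConjecture.HodgeConjecture.…`
-- (single-problem summit: Problem = Summit), which `linter.dupNamespace` flags; set so that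
-- stand-alone elaboration is warning-free.
set_option linter.dupNamespace false

noncomputable section

namespace Summit.HodgeConjecture.HodgeConjecture.Theorems

open CategoryTheory AlgebraicGeometry
open Literature.AlgebraicGeometry Literature.AlgebraicGeometry.Motives
open Literature.AlgebraicGeometry.HodgeTheory
open Literature.AlgebraicTopology.SingularHomology
open Summit.HodgeConjecture.HodgeConjecture.Theses

/-- **The crux modulo Voisin's flat spread and Voisin II Prop. 4.23.** `AbsoluteReduction` follows
from the named facts `voisin2007_flatSpread_of_isAbsoluteHodgeClass` (Voisin 2007, §3, first sentence
of the proof of Prop. 1.2) and `voisin2003_rangeRestrict_eq_of_compactification` (Voisin II,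
Prop. 4.23), the latter giving Deligne's partie fixe by the tree's
`deligne_globalInvariantCycles_of_rangeRestrict` (Voisin II Thm. 4.18 being the tree theorem
`deligne1968_invariantClass_fromTotalSpace_holds`), which feeds `absoluteReduction_of_twoLiteratureFacts`.
CONDITIONAL on the two hypotheses. [cite: Voisin2007HodgeLoci, §3, proof of Prop. 1.2]
[cite: VoisinHodgeII2003, Prop. 4.23 and Thm. 4.24] -/
theorem absoluteReduction_of_flatSpread_of_rangeRestrict
    (hAS : voisin2007_flatSpread_of_isAbsoluteHodgeClass)
    (h423 : voisin2003_rangeRestrict_eq_of_compactification) : BoundaryReadout.AbsoluteReduction :=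
  absoluteReduction_of_twoLiteratureFacts hAS (deligne_globalInvariantCycles_of_rangeRestrict h423)

/-- **The crux modulo Voisin's flat spread and the simple-normal-crossings core of Prop. 4.23.**
`AbsoluteReduction` follows from `voisin2007_flatSpread_of_isAbsoluteHodgeClass` and the inclusion
`Im(ι^* : Hᵏ(𝒳(ℂ); ℂ) → Hᵏ(Y(ℂ); ℂ)) ⊆ Im((ι ≫ i)^*)` for `Y →ι 𝒳 →i X'` with `X'` a smooth projective
variety, `X' ∖ i(𝒳) = ⋃ⱼ V(Dⱼ)` a simple normal crossings boundary with smooth strata and `Y` smooth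
projective closed in `𝒳` (`hSNC`, verbatim the hypothesis of the tree's
`voisin2003_rangeRestrict_eq_of_compactification_of_snc`: complex coefficients suffice, the
compactification may be taken irreducible and then log-resolved, Kollár Thm. 3.21). What `hSNC` asks
is Deligne's mixed Hodge structure on `Hᵏ(𝒳(ℂ))` by the logarithmic complex of `(X', ⋃ⱼ V(Dⱼ))`,
`W_k = Im i^*`, and strictness of `ι^*` (Hodge II §3.2). CONDITIONAL.
[cite: VoisinHodgeII2003, Prop. 4.23] [cite: DeligneHodgeII1971, Thm. 3.2.5 and Cor. 3.2.17]
[cite: Kollar2007, Thm. 3.21] -/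
theorem absoluteReduction_of_flatSpread_of_snc
    (hAS : voisin2007_flatSpread_of_isAbsoluteHodgeClass)
    (hSNC : ∀ (𝒳 X' Y : Motives.SchemeOver ℂ) (i : 𝒳 ⟶ X') (ι : Y ⟶ 𝒳) (m n r : ℕ)
      (D : Fin r → X'.left.IdealSheafData),
      Motives.IsSmoothProjective m X' → IsOpenImmersion i.left → Motives.IsSmoothProjective n Y →
      IsClosedImmersion ι.left → Function.Injective D →
      (∀ I : Finset (Fin r),
        SmoothOfRelativeDimension (m - I.card) ((⨆ j ∈ I, D j).subschemeι ≫ X'.hom)) →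
      (Set.range i.left.base)ᶜ = ⋃ j, ((D j).support : Set X'.left) →
      ∀ k : ℕ, LinearMap.range (complexBetti.map ι k).hom ≤
        LinearMap.range (complexBetti.map (ι ≫ i) k).hom) :
    BoundaryReadout.AbsoluteReduction :=
  absoluteReduction_of_flatSpread_of_rangeRestrict hAS
    (voisin2003_rangeRestrict_eq_of_compactification_of_snc hSNC)

/-- **The crux modulo Voisin's flat spread and the vanishing of periods of pure-type classes.**
`AbsoluteReduction` follows from `voisin2007_flatSpread_of_isAbsoluteHodgeClass` and (`hK`): in the
snc situation of `absoluteReduction_of_flatSpread_of_snc`, for `u ∈ Hᵃ(Y(ℂ); ℂ)` of pure Hodge type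
`(p, q)`, `a + k = 2 dim Y`, if `⟨u ∪ (ι ≫ i)^* β, [Y(ℂ)]⟩ = 0` for every class `β` of the smooth
projective compactification `X'` then `⟨u ∪ ι^* α, [Y(ℂ)]⟩ = 0` for every class `α` of the open
`𝒳` — verbatim the hypothesis of the tree's `voisin2003_rangeRestrict_eq_of_compactification_of_periods`,
instantiated at the complex orientation family `complexOrientationFamily` (fundamental classes
`ι_*[X(ℂ)]`; Poincaré duality, the Hodge decomposition of `Y`, the bidegree of the Gysin morphism and
universal coefficients over `ℂ` are theorems of the tree). This is the statement a "principle of two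
types" argument on the logarithmic complex of `(X', D)` supplies. CONDITIONAL.
[cite: VoisinHodgeII2003, Prop. 4.23] [cite: DeligneHodgeIII1974, Cor. 8.2.8]
[cite: HatcherAT2002, §3.3 Thm. 3.30] -/
theorem absoluteReduction_of_flatSpread_of_periods
    (hAS : voisin2007_flatSpread_of_isAbsoluteHodgeClass)
    (hK : ∀ (𝒳 X' Y : Motives.SchemeOver ℂ) (i : 𝒳 ⟶ X') (ι : Y ⟶ 𝒳) (m n r : ℕ)
      (D : Fin r → X'.left.IdealSheafData) (hX' : Motives.IsSmoothProjective m X')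
      (hY : Motives.IsSmoothProjective n Y),
      IsOpenImmersion i.left → IsClosedImmersion ι.left → Function.Injective D →
      (∀ I : Finset (Fin r),
        SmoothOfRelativeDimension (m - I.card) ((⨆ j ∈ I, D j).subschemeι ≫ X'.hom)) →
      (Set.range i.left.base)ᶜ = ⋃ j, ((D j).support : Set X'.left) →
      ∀ (a k p q : ℕ) (hak : a + k = 2 * n), p + q = a → ∀ u : complexBetti Y a,
        IsOfHodgeType n Y a p q u →
        (∀ β : complexBetti X' k, kroneckerPairing ℂ ℂ (Motives.ComplexPoints Y) (2 * n)
            (cupProduct hak u (complexBetti.map (ι ≫ i) k β))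
            (complexOrientationFamily hY).fundamentalClass = 0) →
        ∀ α : complexBetti 𝒳 k, kroneckerPairing ℂ ℂ (Motives.ComplexPoints Y) (2 * n)
            (cupProduct hak u (complexBetti.map ι k α))
            (complexOrientationFamily hY).fundamentalClass = 0) :
    BoundaryReadout.AbsoluteReduction :=
  absoluteReduction_of_flatSpread_of_rangeRestrict hAS
    (voisin2003_rangeRestrict_eq_of_compactification_of_periods complexOrientationFamily hK)

end Summit.HodgeConjecture.HodgeConjecture.Theorems

end
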